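import Summits.BirchSwinnertonDyer.BirchSwinnertonDyer.Theorems.ClassRecordThreeCornerAtThreeShimuraFamilyKummerPlaces
import Summits.BirchSwinnertonDyer.BirchSwinnertonDyer.Theorems.ClassRecordThreeEulerHalvesAtThreeWalkSupplySelmer
import Summits.BirchSwinnertonDyer.BirchSwinnertonDyer.Theorems.Rank1ResidualJetKolyvaginClassLocal
import HarnessLib

/-!
# The Kummer part of the walk's `hselmer` ∕ `hκSel` for a family of GENERALISED Kolyvagin data on a Shimura frame, in the WALK's currency
# (`galoisCohomology.localization … v 1`, `kummerSelmerStructure`, `Place K` incl. the complex place) and for the ROOT classes `c_k(P_m∕p^u)`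
# (cell `bsd-stepL`, seat `bsd-stepL-corner3-p2` g8 = WIDTH-LEVER lane B; `--supports stmt-BirchSwinnertonDyer-21420 --as helper`)

WHY (CORNER3-G8.md §4 (β)). p600152 `kolyvaginClass_familyData_mem_selmerLocalKer` gives Gross 6.2 (1) for the family datum at every finite `v ∤ m`
in x11b3's currency (`selmerLocalKer (E∕K) K_v`). The walk (bsd-jet ∕ tam3-p1, `hselmer`, `hκSel`) reads Jetchev's currency: `loc_v c ∈ H¹_Kum(K_v, E[p^k])`
at every PLACE `v` of `K` not over the conductor (complex places included), and for the ROOT classes `κ̃ = c_k(Q)`, `p^u Q = P_m` ([J] §3.1 item 7).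
THIS FILE (twins of bsd-jet's `localization_kolyvaginClass_mem_kummerSelmerStructure_of_GZ31` and tam3-p1's `localization_rootClass_mem_kummer`):
* `localization_kolyvaginClass_familyData_mem_kummerSelmerStructure` — the class `(d m hm).kolyvaginClass hp M` at every `v : Place K` not over
  a prime factor of `m` (complex place: `H¹(ℂ, ·) = 0`, pv-1; finite: p600152 through `comap_localization_kummerSelmerStructure`);
* `localization_rootClass_familyData_mem_kummerSelmerStructure` — the ROOT class `c_k(Q)` (`p^u Q = (d m).derivedPoint`) wherever `c_{k+u}(m)` is
  Kummer: change of level `ι_* c_k(Q) = c_{k+u}(m)` (corner-p1's `X11b.Three.Koly.torsionH1OfDvd_kolyvaginClass_of_zsmul` on the datum) + the cartesian local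
  Kummer kernel (`mem_selmerLocalKer_iff_torsionH1OfDvd_mem`) — proof = tam3-p1's, datum re-keyed.
HONEST FRAMING: theorems only (no definition, no named fact, no `sorry`); currency conversion + change of level; CONDITIONAL on the labels of
p600152; nothing about any curve; no stub closes; BSD is not proved by any of this; T7. Credit: bsd-jet pv-1∕pv-2, tam3-p1, corner-p1 g15.
References: [cite: GrossLMS1991, §6 Prop. 6.2 (1), §4 (4.4), (4.6)] [cite: McCallumLMS1991, §4 Lemma 4.3, Lemma 4.6]
[cite: Jetchev2008, §3.1 item 7, §3.3.1, Prop. 4.6] [cite: SilvermanAEC2009, X.§4 Remark 4.1.1].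
presearch: not applicable (re-keying of tree theorems); `lean search 'familyData_mem_kummerSelmerStructure'` → none.
-/

set_option autoImplicit false
set_option linter.dupNamespace false

noncomputable section

open scoped Classical

namespace Summit.BirchSwinnertonDyer.BirchSwinnertonDyer.Theorems.ShimuraWalk

open WeierstrassCurve Field NumberField IsDedekindDomain Finset
  Literature.NumberTheory.EllipticCurves Literature.NumberTheory.GaloisRepresentations
  Literature.NumberTheory.EllipticCurves.KolyvaginCocycle
  Literature.NumberTheory.EllipticCurves.RingClassField
  Literature.NumberTheory.EllipticCurves.ModularForms
  Literature.NumberTheory.GaloisCohomology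
  Summit.BirchSwinnertonDyer.Rank1Residual.X11b Summit.BirchSwinnertonDyer.Rank1Residual.X11b.Three
  Summit.BirchSwinnertonDyer.Rank1Residual.JET
  Summit.BirchSwinnertonDyer.BirchSwinnertonDyer.Theorems

variable {K : Type} [Field K] [NumberField K] {W : WeierstrassCurve ℚ} {ι : K →+* ℂ}

/-- **Gross 6.2 (1) for the family datum in the WALK's currency**: at every place `v` of `K` not over a prime factor of `m` (complex places included),
`loc_v c_M(m) ∈ H¹_Kum(K_v, E[p^M])` — p600152 read through `comap_localization_kummerSelmerStructure`, `H¹(ℂ, ·) = 0` at the complex place.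
[cite: GrossLMS1991, §6 Prop. 6.2 (1)] [cite: Jetchev2008, §3.3.1, Prop. 4.6] -/
theorem localization_kolyvaginClass_familyData_mem_kummerSelmerStructure {N : ℕ} [NeZero N] [W.IsElliptic] [W.IsGloballyMinimal]
    (hK : IsImaginaryQuadratic K) (ι : K →+* ℂ) (hN : W.conductorNorm ℤ = N)
    {p M : ℕ} (hp : p.Prime) (hM : 1 ≤ M) (Dt : ModularParametrizationData W N)
    {S : Finset ℕ}
    (hin : ∀ ℓ ∈ S, ℓ.Prime ∧ ℓ ∣ N ∧ ¬ ℓ ^ 2 ∣ N ∧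
      ((Ideal.span {(ℓ : ℤ)}).primesOver (𝓞 K)).ncard = 1 ∧ ¬ (ℓ : ℤ) ∣ NumberField.discr K)
    {n : ℕ} (hn : Squarefree n)
    (hKol : ∀ q ∈ n.primeFactors, IsKolyvaginPrime N W K p q ∧ FrobEqFrobInfty W K (p ^ M) q)
    (d : (m : ℕ) → m ∣ n → KolyvaginFamilyData W K ι m)
    (hB4d : ∀ (m : ℕ) (hm : m ∣ n), ∀ (ℓ : ℕ) (hℓ : ℓ ∈ m.primeFactors)
      (hle : ringClassField K ι (m / ℓ) ≤ ringClassField K ι m),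
      ∑ i ∈ Finset.range (ℓ + 1), pointGalHom W (ringClassField K ι m) ((d m hm).σ ℓ ^ i) (d m hm).y =
        W.frobeniusTrace ℓ • WeierstrassCurve.Affine.Point.map (W' := W)
          ((RingClassField.inclusion ι hle).restrictScalars ℚ)
          (d (m / ℓ) ((Nat.div_dvd_of_dvd (Nat.dvd_of_mem_primeFactors hℓ)).trans hm)).y)
    {n' : ℤ} (hcop : IsCoprime ((p ^ M : ℕ) : ℤ) n')
    (hrec : ∀ (q : ℕ), q.Prime → q ∣ N → q ∉ S → ∀ (m : ℕ) (hm : m ∣ n)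
      (γ : ringClassField K ι m ≃ₐ[ℚ] ringClassField K ι m) (v : HeightOneSpectrum (𝓞 K)),
      ((q : ℕ) : 𝓞 K) ∈ v.asIdeal →
        n' • pointsMap (W.baseChange K) (v.adicCompletion K)
            ((d m hm).toGeomPoints (pointGalHom W (ringClassField K ι m) γ (d m hm).y)) ∈
          E0Receptacle (W.baseChange K) v ∧
        ∀ (ℓ : ℕ) (hℓ : ℓ ∈ m.primeFactors)
          (hle : ringClassField K ι (m / ℓ) ≤ ringClassField K ι m),
          n' • pointsMap (W.baseChange K) (v.adicCompletion K)
              ((d m hm).toGeomPoints (pointGalHom W (ringClassField K ι m) γ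
                (WeierstrassCurve.Affine.Point.map (W' := W)
                  ((RingClassField.inclusion ι hle).restrictScalars ℚ)
                  (d (m / ℓ) ((Nat.div_dvd_of_dvd (Nat.dvd_of_mem_primeFactors hℓ)).trans hm)).y))) ∈
            E0Receptacle (W.baseChange K) v)
    (hA : ∀ (m : ℕ) (hm : m ∣ n),
      IsAdmissible (absoluteGaloisGroup K) (d m hm).pointsSubgroup ((p ^ M : ℕ) : ℤ))
    (m : ℕ) (hm : m ∣ n) (v : Place K) (hv : ∀ ℓ ∈ m.primeFactors, ¬ Jetchev2008.PlaceOver K v ℓ) :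
    galoisCohomology.localization ((W.baseChange K).torsionGaloisModule ((p ^ M : ℕ) : ℤ)) v 1
        ((d m hm).kolyvaginClass hp M) ∈
      (W.baseChange K).kummerSelmerStructure ((p ^ M : ℕ) : ℤ) v := by
  rcases v with w | 𝔳
  · -- complex place: `H¹(ℂ, ·) = 0`
    haveI : IsTotallyComplex K := hK.2
    have hw : w.IsComplex := IsTotallyComplex.isComplex w
    have htop := GlobalDuality.addSubgroup_galoisCohomology_inl_eq_top_of_isComplex
      ((W.baseChange K).torsionGaloisModule ((p ^ M : ℕ) : ℤ)) hw
      ((W.baseChange K).kummerSelmerStructure ((p ^ M : ℕ) : ℤ) (Sum.inl w))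
    rw [htop]
    exact AddSubgroup.mem_top _
  · -- finite place `𝔳 ∤ m`
    have hmv : (m : 𝓞 K) ∉ 𝔳.asIdeal := fun h ↦ by
      obtain ⟨ℓ, hℓ, hℓv⟩ := exists_primeFactor_mem_of_natCast_mem
        (hn.squarefree_of_dvd hm) 𝔳 h
      exact hv ℓ hℓ ⟨𝔳, rfl, hℓv⟩
    rw [← AddSubgroup.mem_comap, (W.baseChange K).comap_localization_kummerSelmerStructure]
    exact kolyvaginClass_familyData_mem_selmerLocalKer hK ι hN hp hM Dt hin hn hKol d hB4d hcop hrec hA m hm 𝔳 hmv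

/-- **The ROOT class `c_k(Q)` of a family datum is Kummer wherever `c_{k+u}(m)` is** (`p^u Q = (d m).derivedPoint`): the change of level
`ι_* c_k(Q) = c_{k+u}(m)` (corner-p1's `X11b.Three.Koly.torsionH1OfDvd_kolyvaginClass_of_zsmul`) and the cartesian local Kummer kernel
(`mem_selmerLocalKer_iff_torsionH1OfDvd_mem`) — tam3-p1's `localization_rootClass_mem_kummer`, datum re-keyed; admissibility at `p^{k+u}` a hypothesis.
[cite: McCallumLMS1991, §4 Lemma 4.3, Lemma 4.6] [cite: Jetchev2008, §3.1 item 7] [cite: SilvermanAEC2009, X.§4 Remark 4.1.1] -/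
theorem localization_rootClass_familyData_mem_kummerSelmerStructure [W.IsElliptic]
    {m : ℕ} (d : KolyvaginFamilyData W K ι m) {p : ℕ} (hp : p.Prime) (k u : ℕ)
    (hA : IsAdmissible (absoluteGaloisGroup K) d.pointsSubgroup ((p ^ (k + u) : ℕ) : ℤ))
    (Q : (W.baseChange (ringClassField K ι m)).toAffine.Point)
    (hAk : IsAdmissible (absoluteGaloisGroup K) d.pointsSubgroup ((p ^ k : ℕ) : ℤ))
    (hQ : d.toGeomPoints Q ∈ invPoints (absoluteGaloisGroup K) d.pointsSubgroup ((p ^ k : ℕ) : ℤ))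
    (hQP : ((p ^ u : ℕ) : ℤ) • Q = d.derivedPoint)
    (hP : d.toGeomPoints d.derivedPoint ∈
      invPoints (absoluteGaloisGroup K) d.pointsSubgroup ((p ^ (k + u) : ℕ) : ℤ))
    (v : Place K)
    (hv : galoisCohomology.localization ((W.baseChange K).torsionGaloisModule ((p ^ (k + u) : ℕ) : ℤ)) v 1
        (d.kolyvaginClass hp (k + u)) ∈
      (W.baseChange K).kummerSelmerStructure ((p ^ (k + u) : ℕ) : ℤ) v) :
    galoisCohomology.localization ((W.baseChange K).torsionGaloisModule ((p ^ k : ℕ) : ℤ)) v 1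
        (kolyvaginClass (W.baseChange K) ((p ^ k : ℕ) : ℤ)
          ((W.baseChange K).zsmul_geomPoints_surjective_of_charZero
            (by exact_mod_cast pow_ne_zero k hp.ne_zero)) hAk (d.toGeomPoints Q) hQ) ∈
      (W.baseChange K).kummerSelmerStructure ((p ^ k : ℕ) : ℤ) v := by
  -- adapted from tam3-p1's `JET.Walk.localization_rootClass_mem_kummer` (datum type replaced)
  have hdn : ((p ^ k : ℕ) : ℤ) ∣ ((p ^ (k + u) : ℕ) : ℤ) := by
    exact_mod_cast pow_dvd_pow p (Nat.le_add_right k u)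
  -- the change of level on the SAME McCallum cocycle: `ι_* c_k(Q) = c_{k+u}(P)`
  have hlevel : WeierstrassCurve.torsionH1OfDvd (W.baseChange K) hdn
      (kolyvaginClass (W.baseChange K) ((p ^ k : ℕ) : ℤ)
        ((W.baseChange K).zsmul_geomPoints_surjective_of_charZero
          (by exact_mod_cast pow_ne_zero k hp.ne_zero)) hAk (d.toGeomPoints Q) hQ) =
      d.kolyvaginClass hp (k + u) := by
    rw [KolyvaginFamilyData.kolyvaginClass_def, dif_pos ⟨hA, hP⟩]
    refine Summit.BirchSwinnertonDyer.Rank1Residual.X11b.Three.Koly.torsionH1OfDvd_kolyvaginClass_of_zsmul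
      (W.baseChange K) _ (m := ((p ^ u : ℕ) : ℤ)) ?_ _ _ hAk hA hQ ?_ hP
    · push_cast; ring
    · rw [← map_zsmul, hQP]
  have key : WeierstrassCurve.torsionH1OfDvd (W.baseChange K) hdn
      (kolyvaginClass (W.baseChange K) ((p ^ k : ℕ) : ℤ)
        ((W.baseChange K).zsmul_geomPoints_surjective_of_charZero
          (by exact_mod_cast pow_ne_zero k hp.ne_zero)) hAk (d.toGeomPoints Q) hQ) ∈
      selmerLocalKer (W.baseChange K) (Place.Completion v) ((p ^ (k + u) : ℕ) : ℤ) := by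
    rw [hlevel, ← (W.baseChange K).comap_localization_kummerSelmerStructure]
    exact hv
  rw [← AddSubgroup.mem_comap, (W.baseChange K).comap_localization_kummerSelmerStructure]
  exact (Summit.BirchSwinnertonDyer.BirchSwinnertonDyer.Theorems.mem_selmerLocalKer_iff_torsionH1OfDvd_mem
    (W.baseChange K) (Place.Completion v) hdn _).mpr key

end Summit.BirchSwinnertonDyer.BirchSwinnertonDyer.Theorems.ShimuraWalk

end
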